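import Mathlib
import HarnessLib

/-!
# Two-copy BHK, I: the abstract contraction argument and the finite two-copy pairing

builds on p205010 (kernel theorem, internal audit signed; external expert review pending).  Support file (`--supports
stmt-CriticalPhenomena-4575`), lead seat `prim-nh-lead-4575` (gen 105); memo `run/shared/lean/prim/prim-nh-lead-4575/LEAD-GEN105.md` §1(6).
Theorems only; no sorries; standard axioms; default heartbeats.

SETTING (generic).  A finite type `Ω` (configurations), nonnegative weights `p` with `∑ p = 1`, and a symmetric `{0,1}`-valued
kernel `χ ω η` ("the pair `(ω, η)` is compatible" — for the hard-core reduction: no vertex of the hard-core set is joined to the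
sources in both copies).  Put `r ω = ∑_η p η χ ω η` (the compatible mass seen from `ω`), `m_F ω = ∑_η p η F η χ ω η`,
the AVERAGING OPERATOR `(T F) ω = m_F ω / r ω`, the two-copy weights `q ω = p ω r ω` and the two-copy covariance form
`B(F, G) = (∑ q F G)(∑ q) − (∑ q F)(∑ q G)`.

* `nonneg_of_contraction` — ABSTRACT ITERATION: if `T` exchanges two classes `I`, `D` of functions, does not increase `B` on pairs
  from one class, contracts oscillations by a factor `θ < 1`, and `|B(F,G)| ≤ P · osc F · osc G`, then `B ≥ 0` on `I × I`
  (`B(F,G) ≥ B(TⁿF,TⁿG) → 0`).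
* `sum_mul_kernelSum_comm` — SYMMETRY of the pairing: `∑_ω p ω A ω m_B ω = ∑_ω p ω B ω m_A ω`.
* `twoCopyForm_step` — ONE STEP: if `m_F m_G ≤ m_{FG} · r` pointwise (conditional positive association seen from every `ω`),
  then `B(TF, TG) ≤ B(F, G)`.
* `averaging_contraction` — DOEBLIN: if a fixed set of mass `δ > 0` is compatible with everything, `osc (T F) ≤ (1 − δ) osc F`.
* `twoCopyForm_abs_le` — `|B(F, G)| ≤ (∑ q)² · osc F · osc G`.
* `twoCopyForm_nonneg`, `twoCopy_cross_le` — the assembled generic statements: `B ≥ 0` on `I × I`, and the "hard-core Harris"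
  form `∑_ω p ω a ω m_b ω ≤ ∑_ω q ω a ω b ω` for `a, b ∈ I` (cross-copy ≤ same-copy).
Part II (`…ConstsTwoCopyBHKMeasure.lean`) instantiates this with bond percolation, the hard-core kernel and BHK's Theorem 1.3.
-/

namespace Summit.CriticalPhenomena.PercolationContinuityZ3.Theorems

namespace Consts.TwoCopy

open Finset

variable {Ω : Type*} [Fintype Ω]

/-- **Abstract contraction argument.**  `T` exchanges the classes `I` and `D`, does not increase `B` on pairs from one class,
contracts oscillations by `θ < 1`, and `B` is bounded by `P · osc · osc`; then `B(F, G) ≥ 0` for `F, G ∈ I`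
(from `B(F,G) ≥ B(TⁿF, TⁿG) ≥ −P θ^{2n} osc F osc G → 0`). [folklore] -/
theorem nonneg_of_contraction (I D : (Ω → ℝ) → Prop) (T : (Ω → ℝ) → (Ω → ℝ)) (B : (Ω → ℝ) → (Ω → ℝ) → ℝ)
    (θ P : ℝ) (hθ0 : 0 ≤ θ) (hθ1 : θ < 1)
    (hTI : ∀ F, I F → D (T F)) (hTD : ∀ F, D F → I (T F))
    (hstepI : ∀ F G, I F → I G → B (T F) (T G) ≤ B F G)
    (hstepD : ∀ F G, D F → D G → B (T F) (T G) ≤ B F G)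
    (hcontr : ∀ (F : Ω → ℝ) (a L : ℝ), 0 ≤ L → (∀ ω, a ≤ F ω ∧ F ω ≤ a + L) →
      ∃ a' : ℝ, ∀ ω, a' ≤ T F ω ∧ T F ω ≤ a' + θ * L)
    (hbound : ∀ (F G : Ω → ℝ) (a L c K : ℝ), 0 ≤ L → 0 ≤ K → (∀ ω, a ≤ F ω ∧ F ω ≤ a + L) →
      (∀ ω, c ≤ G ω ∧ G ω ≤ c + K) → -(P * L * K) ≤ B F G)
    (F G : Ω → ℝ) (hF : I F) (hG : I G) : 0 ≤ B F G := by
  -- the iteration, with explicit oscillation bounds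
  have key : ∀ n : ℕ, ∀ (F G : Ω → ℝ) (a L c K : ℝ), 0 ≤ L → 0 ≤ K →
      ((I F ∧ I G) ∨ (D F ∧ D G)) → (∀ ω, a ≤ F ω ∧ F ω ≤ a + L) → (∀ ω, c ≤ G ω ∧ G ω ≤ c + K) →
      -(P * (θ ^ n * L) * (θ ^ n * K)) ≤ B F G := by
    intro n
    induction n with
    | zero =>
      intro F G a L c K hL hK _ hbF hbG
      simpa using hbound F G a L c K hL hK hbF hbG
    | succ n ih =>
      intro F G a L c K hL hK hcl hbF hbG
      obtain ⟨a', hTF⟩ := hcontr F a L hL hbF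
      obtain ⟨c', hTG⟩ := hcontr G c K hK hbG
      have hcl' : (I (T F) ∧ I (T G)) ∨ (D (T F) ∧ D (T G)) := by
        rcases hcl with ⟨h1, h2⟩ | ⟨h1, h2⟩
        · exact Or.inr ⟨hTI _ h1, hTI _ h2⟩
        · exact Or.inl ⟨hTD _ h1, hTD _ h2⟩
      have hstep : B (T F) (T G) ≤ B F G := by
        rcases hcl with ⟨h1, h2⟩ | ⟨h1, h2⟩
        · exact hstepI _ _ h1 h2
        · exact hstepD _ _ h1 h2
      have h := ih (T F) (T G) a' (θ * L) c' (θ * K) (mul_nonneg hθ0 hL) (mul_nonneg hθ0 hK) hcl' hTF hTG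
      calc -(P * (θ ^ (n + 1) * L) * (θ ^ (n + 1) * K))
          = -(P * (θ ^ n * (θ * L)) * (θ ^ n * (θ * K))) := by ring
        _ ≤ B (T F) (T G) := h
        _ ≤ B F G := hstep
  -- crude initial bounds
  set M : ℝ := ∑ ω, |F ω| with hM
  set M' : ℝ := ∑ ω, |G ω| with hM'
  have hbF : ∀ ω, -M ≤ F ω ∧ F ω ≤ -M + 2 * M := fun ω => by
    have h : |F ω| ≤ M := Finset.single_le_sum (f := fun ω => |F ω|) (fun _ _ => abs_nonneg _) (Finset.mem_univ ω)
    constructor <;> linarith [neg_abs_le (F ω), le_abs_self (F ω)]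
  have hbG : ∀ ω, -M' ≤ G ω ∧ G ω ≤ -M' + 2 * M' := fun ω => by
    have h : |G ω| ≤ M' := Finset.single_le_sum (f := fun ω => |G ω|) (fun _ _ => abs_nonneg _) (Finset.mem_univ ω)
    constructor <;> linarith [neg_abs_le (G ω), le_abs_self (G ω)]
  have hM0 : 0 ≤ M := Finset.sum_nonneg fun _ _ => abs_nonneg _
  have hM'0 : 0 ≤ M' := Finset.sum_nonneg fun _ _ => abs_nonneg _
  have hn : ∀ n : ℕ, -(P * (2 * M) * (2 * M')) * (θ ^ n) ^ 2 ≤ B F G := fun n => by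
    have h := key n F G (-M) (2 * M) (-M') (2 * M') (by linarith) (by linarith) (Or.inl ⟨hF, hG⟩) hbF hbG
    calc -(P * (2 * M) * (2 * M')) * (θ ^ n) ^ 2 = -(P * (θ ^ n * (2 * M)) * (θ ^ n * (2 * M'))) := by ring
      _ ≤ B F G := h
  -- let `n → ∞`
  have hlim : Filter.Tendsto (fun n : ℕ => -(P * (2 * M) * (2 * M')) * (θ ^ n) ^ 2) Filter.atTop (nhds 0) := by
    have h := (tendsto_pow_atTop_nhds_zero_of_lt_one hθ0 hθ1).pow 2
    simpa using h.const_mul (-(P * (2 * M) * (2 * M')))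
  exact le_of_tendsto' hlim hn

/-- **Symmetry of the two-copy pairing.**  For a symmetric kernel, `∑_ω p ω A ω (∑_η p η B η χ ω η) = ∑_ω p ω B ω (∑_η p η A η χ ω η)`
(both are the double sum of `p ω p η A ω B η χ ω η`). [folklore] -/
theorem sum_mul_kernelSum_comm (p : Ω → ℝ) (χ : Ω → Ω → ℝ) (hχ : ∀ ω η, χ ω η = χ η ω) (A B : Ω → ℝ) :
    ∑ ω, p ω * (A ω * ∑ η, p η * (B η * χ ω η)) = ∑ ω, p ω * (B ω * ∑ η, p η * (A η * χ ω η)) := by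
  have h1 : ∀ ω, p ω * (A ω * ∑ η, p η * (B η * χ ω η)) = ∑ η, p ω * A ω * (p η * B η) * χ ω η := fun ω => by
    rw [Finset.mul_sum, Finset.mul_sum]
    exact Finset.sum_congr rfl fun η _ => by ring
  have h2 : ∀ ω, p ω * (B ω * ∑ η, p η * (A η * χ ω η)) = ∑ η, p η * A η * (p ω * B ω) * χ ω η := fun ω => by
    rw [Finset.mul_sum, Finset.mul_sum]
    exact Finset.sum_congr rfl fun η _ => by ring
  rw [Finset.sum_congr rfl fun ω _ => h1 ω, Finset.sum_congr rfl fun ω _ => h2 ω, Finset.sum_comm]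
  exact Finset.sum_congr rfl fun ω _ => Finset.sum_congr rfl fun η _ => by rw [hχ]

/-- **The averaging operator preserves `q`-means**: with `(T F) ω · r ω = m_F ω` and `q = p · r`,
`∑ q (T F) = ∑ q F` (symmetry of the pairing). [folklore] -/
theorem averaging_mean (p : Ω → ℝ) (χ : Ω → Ω → ℝ) (hχ : ∀ ω η, χ ω η = χ η ω) (F TF : Ω → ℝ)
    (hTF : ∀ ω, TF ω * (∑ η, p η * χ ω η) = ∑ η, p η * (F η * χ ω η)) :
    ∑ ω, p ω * (∑ η, p η * χ ω η) * TF ω = ∑ ω, p ω * (∑ η, p η * χ ω η) * F ω := by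
  have h1 : ∑ ω, p ω * (∑ η, p η * χ ω η) * TF ω = ∑ ω, p ω * ((fun _ => (1 : ℝ)) ω * ∑ η, p η * (F η * χ ω η)) :=
    Finset.sum_congr rfl fun ω _ => by rw [one_mul, ← hTF ω]; ring
  have h2 : ∑ ω, p ω * (∑ η, p η * χ ω η) * F ω = ∑ ω, p ω * (F ω * ∑ η, p η * ((fun _ => (1 : ℝ)) η * χ ω η)) :=
    Finset.sum_congr rfl fun ω _ => by simp only [one_mul]; ring
  rw [h1, h2, sum_mul_kernelSum_comm p χ hχ]

/-- **One step of the iteration.**  With `r ω = ∑_η p η χ ω η`, `m_X ω = ∑_η p η X η χ ω η` and the averaging operator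
characterised by `(T X) ω · r ω = m_X ω`: if `m_F ω · m_G ω ≤ m_{FG} ω · r ω` for every `ω` (positive association of the
compatible configurations seen from `ω`), then `B(TF, TG) ≤ B(F, G)` for the two-copy form with weights `q = p · r`.
[folklore] -/
theorem twoCopyForm_step (p : Ω → ℝ) (hp : ∀ ω, 0 ≤ p ω) (χ : Ω → Ω → ℝ) (hχ : ∀ ω η, χ ω η = χ η ω)
    (hχ0 : ∀ ω η, 0 ≤ χ ω η) (F G TF TG : Ω → ℝ)
    (hTF : ∀ ω, TF ω * (∑ η, p η * χ ω η) = ∑ η, p η * (F η * χ ω η))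
    (hTG : ∀ ω, TG ω * (∑ η, p η * χ ω η) = ∑ η, p η * (G η * χ ω η))
    (hPA : ∀ ω, (∑ η, p η * (F η * χ ω η)) * (∑ η, p η * (G η * χ ω η)) ≤
      (∑ η, p η * (F η * G η * χ ω η)) * (∑ η, p η * χ ω η)) :
    (∑ ω, p ω * (∑ η, p η * χ ω η) * (TF ω * TG ω)) * (∑ ω, p ω * (∑ η, p η * χ ω η)) -
        (∑ ω, p ω * (∑ η, p η * χ ω η) * TF ω) * (∑ ω, p ω * (∑ η, p η * χ ω η) * TG ω) ≤
      (∑ ω, p ω * (∑ η, p η * χ ω η) * (F ω * G ω)) * (∑ ω, p ω * (∑ η, p η * χ ω η)) -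
        (∑ ω, p ω * (∑ η, p η * χ ω η) * F ω) * (∑ ω, p ω * (∑ η, p η * χ ω η) * G ω) := by
  -- abbreviations
  set r : Ω → ℝ := fun ω => ∑ η, p η * χ ω η with hr
  have hr0 : ∀ ω, 0 ≤ r ω := fun ω => Finset.sum_nonneg fun η _ => mul_nonneg (hp η) (hχ0 ω η)
  -- if `r ω = 0` every compatible term vanishes
  have hzero : ∀ ω, r ω = 0 → ∀ X : Ω → ℝ, ∑ η, p η * (X η * χ ω η) = 0 := by
    intro ω hω X
    have hterm : ∀ η, p η * χ ω η = 0 := fun η =>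
      (Finset.sum_eq_zero_iff_of_nonneg fun η _ => mul_nonneg (hp η) (hχ0 ω η)).1 hω η (Finset.mem_univ η)
    exact Finset.sum_eq_zero fun η _ => by
      calc p η * (X η * χ ω η) = X η * (p η * χ ω η) := by ring
        _ = 0 := by rw [hterm η, mul_zero]
  -- (i) the `T`-averages have the same `q`-means
  have hmeanF : ∑ ω, p ω * r ω * TF ω = ∑ ω, p ω * r ω * F ω := averaging_mean p χ hχ F TF hTF
  have hmeanG : ∑ ω, p ω * r ω * TG ω = ∑ ω, p ω * r ω * G ω := averaging_mean p χ hχ G TG hTG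
  -- (ii) the mixed moment does not increase
  have hFG : ∑ ω, p ω * r ω * (F ω * G ω) = ∑ ω, p ω * ∑ η, p η * (F η * G η * χ ω η) := by
    have h2 : ∑ ω, p ω * r ω * (F ω * G ω) =
        ∑ ω, p ω * ((fun ω => F ω * G ω) ω * ∑ η, p η * ((fun _ => (1 : ℝ)) η * χ ω η)) :=
      Finset.sum_congr rfl fun ω _ => by simp only [one_mul, hr]; ring
    rw [h2, ← sum_mul_kernelSum_comm p χ hχ]
    exact Finset.sum_congr rfl fun ω _ => by simp only [one_mul]
  have hmix : ∑ ω, p ω * r ω * (TF ω * TG ω) ≤ ∑ ω, p ω * r ω * (F ω * G ω) := by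
    rw [hFG]
    refine Finset.sum_le_sum fun ω _ => ?_
    rcases (hr0 ω).eq_or_lt with hω | hω
    · -- `r ω = 0`: both sides vanish
      have h0 := hzero ω hω.symm (fun η => F η * G η)
      rw [← hω, h0, mul_zero, zero_mul]
    · -- `r ω > 0`: `r · TF · TG = m_F m_G / r ≤ m_{FG}`
      rw [mul_assoc]
      refine mul_le_mul_of_nonneg_left ?_ (hp ω)
      have hkey : r ω * (TF ω * TG ω) * r ω ≤ (∑ η, p η * (F η * G η * χ ω η)) * r ω := by
        calc r ω * (TF ω * TG ω) * r ω = (TF ω * r ω) * (TG ω * r ω) := by ring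
          _ = (∑ η, p η * (F η * χ ω η)) * (∑ η, p η * (G η * χ ω η)) := by rw [hTF ω, hTG ω]
          _ ≤ _ := hPA ω
      exact le_of_mul_le_mul_right hkey hω
  -- (iii) assemble
  have hq0 : 0 ≤ ∑ ω, p ω * r ω := Finset.sum_nonneg fun ω _ => mul_nonneg (hp ω) (hr0 ω)
  rw [hmeanF, hmeanG]
  exact sub_le_sub_right (mul_le_mul_of_nonneg_right hmix hq0) _

/-- **Doeblin contraction of the averaging operator.**  If a fixed indicator `χ⋆ ≤ χ ω ·` of mass `δ = ∑ p χ⋆ > 0` is compatible with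
every `ω` (and `∑ p = 1`, `χ ≤ 1`), then `a ≤ F ≤ a + L` implies `a' ≤ T F ≤ a' + (1 − δ) L` for a suitable `a'`. [folklore] -/
theorem averaging_contraction (p : Ω → ℝ) (hp : ∀ ω, 0 ≤ p ω) (hsum : ∑ ω, p ω = 1) (χ : Ω → Ω → ℝ)
    (hχ1 : ∀ ω η, χ ω η ≤ 1) (χs : Ω → ℝ) (hχs0 : ∀ η, 0 ≤ χs η) (hχs : ∀ ω η, χs η ≤ χ ω η)
    (δ : ℝ) (hδ : δ = ∑ η, p η * χs η) (hδpos : 0 < δ) (F TF : Ω → ℝ)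
    (hTF : ∀ ω, TF ω * (∑ η, p η * χ ω η) = ∑ η, p η * (F η * χ ω η))
    (a L : ℝ) (hF : ∀ ω, a ≤ F ω ∧ F ω ≤ a + L) :
    ∃ a' : ℝ, ∀ ω, a' ≤ TF ω ∧ TF ω ≤ a' + (1 - δ) * L := by
  refine ⟨a + ((∑ η, p η * (F η * χs η)) - δ * a), fun ω => ?_⟩
  have hχ0 : ∀ η, 0 ≤ χ ω η := fun η => (hχs0 η).trans (hχs ω η)
  -- `δ ≤ r ≤ 1`
  have hδr : δ ≤ ∑ η, p η * χ ω η := by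
    rw [hδ]; exact Finset.sum_le_sum fun η _ => mul_le_mul_of_nonneg_left (hχs ω η) (hp η)
  have hr1 : ∑ η, p η * χ ω η ≤ 1 := by
    rw [← hsum]; exact Finset.sum_le_sum fun η _ => by nlinarith [hp η, hχ1 ω η]
  have hrpos : 0 < ∑ η, p η * χ ω η := hδpos.trans_le hδr
  -- the mass outside `χ⋆` carries values in `[a, a + L]`
  have hlow : (∑ η, p η * (F η * χs η)) + ((∑ η, p η * χ ω η) - δ) * a ≤ ∑ η, p η * (F η * χ ω η) := by
    have h : ∀ η, p η * (F η * χs η) + (p η * χ ω η - p η * χs η) * a ≤ p η * (F η * χ ω η) := fun η => by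
      nlinarith [mul_nonneg (mul_nonneg (hp η) (sub_nonneg.2 (hχs ω η))) (sub_nonneg.2 (hF η).1)]
    have key := Finset.sum_le_sum fun η (_ : η ∈ Finset.univ) => h η
    rw [Finset.sum_add_distrib, ← Finset.sum_mul, Finset.sum_sub_distrib, ← hδ] at key
    exact key
  have hupp : ∑ η, p η * (F η * χ ω η) ≤ (∑ η, p η * (F η * χs η)) + ((∑ η, p η * χ ω η) - δ) * (a + L) := by
    have h : ∀ η, p η * (F η * χ ω η) ≤ p η * (F η * χs η) + (p η * χ ω η - p η * χs η) * (a + L) := fun η => by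
      nlinarith [mul_nonneg (mul_nonneg (hp η) (sub_nonneg.2 (hχs ω η))) (sub_nonneg.2 (hF η).2)]
    have key := Finset.sum_le_sum fun η (_ : η ∈ Finset.univ) => h η
    rw [Finset.sum_add_distrib, ← Finset.sum_mul, Finset.sum_sub_distrib, ← hδ] at key
    exact key
  -- `s - δ a ≥ 0` and `s - δ a - δ L ≤ 0`
  have hs1 : δ * a ≤ ∑ η, p η * (F η * χs η) := by
    have h : ∀ η, p η * χs η * a ≤ p η * (F η * χs η) := fun η => by
      nlinarith [mul_nonneg (mul_nonneg (hp η) (hχs0 η)) (sub_nonneg.2 (hF η).1)]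
    have key := Finset.sum_le_sum fun η (_ : η ∈ Finset.univ) => h η
    rw [← Finset.sum_mul, ← hδ] at key
    exact key
  have hs2 : ∑ η, p η * (F η * χs η) ≤ δ * (a + L) := by
    have h : ∀ η, p η * (F η * χs η) ≤ p η * χs η * (a + L) := fun η => by
      nlinarith [mul_nonneg (mul_nonneg (hp η) (hχs0 η)) (sub_nonneg.2 (hF η).2)]
    have key := Finset.sum_le_sum fun η (_ : η ∈ Finset.univ) => h η
    rw [← Finset.sum_mul, ← hδ] at key
    exact key
  have hTFω := hTF ω
  constructor
  · -- lower bound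
    refine le_of_mul_le_mul_right ?_ hrpos
    rw [hTFω]
    nlinarith [hlow, hs1, hr1, hrpos, mul_nonneg (sub_nonneg.2 hr1) (sub_nonneg.2 hs1)]
  · -- upper bound
    refine le_of_mul_le_mul_right ?_ hrpos
    rw [hTFω]
    nlinarith [hupp, hs2, hr1, hrpos, mul_nonneg (sub_nonneg.2 hr1) (sub_nonneg.2 hs2)]

/-- **The two-copy form is bounded by the oscillations**: for nonnegative weights `q`, `a ≤ F ≤ a + L` and `c ≤ G ≤ c + K`,
`−(∑ q)² L K ≤ (∑ q F G)(∑ q) − (∑ q F)(∑ q G)` (shift to `F − a`, `G − c`). [folklore] -/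
theorem twoCopyForm_abs_le (q : Ω → ℝ) (hq : ∀ ω, 0 ≤ q ω) (F G : Ω → ℝ) (a L c K : ℝ) (hL : 0 ≤ L)
    (hF : ∀ ω, a ≤ F ω ∧ F ω ≤ a + L) (hG : ∀ ω, c ≤ G ω ∧ G ω ≤ c + K) :
    -((∑ ω, q ω) * (∑ ω, q ω) * L * K) ≤
      (∑ ω, q ω * (F ω * G ω)) * (∑ ω, q ω) - (∑ ω, q ω * F ω) * (∑ ω, q ω * G ω) := by
  set P : ℝ := ∑ ω, q ω with hP
  set sF : ℝ := ∑ ω, q ω * (F ω - a) with hsF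
  set sG : ℝ := ∑ ω, q ω * (G ω - c) with hsG
  set sFG : ℝ := ∑ ω, q ω * ((F ω - a) * (G ω - c)) with hsFG
  have hP0 : 0 ≤ P := Finset.sum_nonneg fun ω _ => hq ω
  have e1 : ∑ ω, q ω * F ω = sF + a * P := by
    simp only [hsF, hP, Finset.mul_sum, ← Finset.sum_add_distrib]
    exact Finset.sum_congr rfl fun ω _ => by ring
  have e2 : ∑ ω, q ω * G ω = sG + c * P := by
    simp only [hsG, hP, Finset.mul_sum, ← Finset.sum_add_distrib]
    exact Finset.sum_congr rfl fun ω _ => by ring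
  have e3 : ∑ ω, q ω * (F ω * G ω) = sFG + c * sF + a * sG + a * c * P := by
    simp only [hsFG, hsF, hsG, hP, Finset.mul_sum, ← Finset.sum_add_distrib]
    exact Finset.sum_congr rfl fun ω _ => by ring
  have hsF0 : 0 ≤ sF := Finset.sum_nonneg fun ω _ => mul_nonneg (hq ω) (sub_nonneg.2 (hF ω).1)
  have hsG0 : 0 ≤ sG := Finset.sum_nonneg fun ω _ => mul_nonneg (hq ω) (sub_nonneg.2 (hG ω).1)
  have hsFG0 : 0 ≤ sFG := Finset.sum_nonneg fun ω _ =>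
    mul_nonneg (hq ω) (mul_nonneg (sub_nonneg.2 (hF ω).1) (sub_nonneg.2 (hG ω).1))
  have hsFL : sF ≤ P * L := by
    rw [hP, Finset.sum_mul]
    exact Finset.sum_le_sum fun ω _ => mul_le_mul_of_nonneg_left (by linarith [(hF ω).2]) (hq ω)
  have hsGK : sG ≤ P * K := by
    rw [hP, Finset.sum_mul]
    exact Finset.sum_le_sum fun ω _ => mul_le_mul_of_nonneg_left (by linarith [(hG ω).2]) (hq ω)
  rw [e1, e2, e3]
  nlinarith [mul_nonneg hP0 hsFG0, mul_le_mul hsFL hsGK hsG0 (mul_nonneg hP0 hL)]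

/-- **Two-copy positive association (generic form).**  Weights `p` (`∑ p = 1`), a symmetric `[0,1]`-kernel `χ` dominating a
fixed indicator `χ⋆` of mass `δ > 0`, classes `I`, `D` exchanged by the averaging operator `T` and positively associated among
the compatible configurations seen from every `ω`; then the two-copy form is nonnegative on `I × I`:
`(∑ q F G)(∑ q) ≥ (∑ q F)(∑ q G)`, `q ω = p ω · r ω`. [folklore] -/
theorem twoCopyForm_nonneg (p : Ω → ℝ) (hp : ∀ ω, 0 ≤ p ω) (hsum : ∑ ω, p ω = 1) (χ : Ω → Ω → ℝ)
    (hχ : ∀ ω η, χ ω η = χ η ω) (hχ1 : ∀ ω η, χ ω η ≤ 1) (χs : Ω → ℝ) (hχs0 : ∀ η, 0 ≤ χs η)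
    (hχs : ∀ ω η, χs η ≤ χ ω η) (δ : ℝ) (hδ : δ = ∑ η, p η * χs η) (hδpos : 0 < δ)
    (I D : (Ω → ℝ) → Prop) (T : (Ω → ℝ) → (Ω → ℝ))
    (hT : ∀ (X : Ω → ℝ) ω, T X ω * (∑ η, p η * χ ω η) = ∑ η, p η * (X η * χ ω η))
    (hTI : ∀ F, I F → D (T F)) (hTD : ∀ F, D F → I (T F))
    (hPAI : ∀ F G, I F → I G → ∀ ω, (∑ η, p η * (F η * χ ω η)) * (∑ η, p η * (G η * χ ω η)) ≤
      (∑ η, p η * (F η * G η * χ ω η)) * (∑ η, p η * χ ω η))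
    (hPAD : ∀ F G, D F → D G → ∀ ω, (∑ η, p η * (F η * χ ω η)) * (∑ η, p η * (G η * χ ω η)) ≤
      (∑ η, p η * (F η * G η * χ ω η)) * (∑ η, p η * χ ω η))
    (F G : Ω → ℝ) (hF : I F) (hG : I G) :
    0 ≤ (∑ ω, p ω * (∑ η, p η * χ ω η) * (F ω * G ω)) * (∑ ω, p ω * (∑ η, p η * χ ω η)) -
        (∑ ω, p ω * (∑ η, p η * χ ω η) * F ω) * (∑ ω, p ω * (∑ η, p η * χ ω η) * G ω) := by
  have hχ0 : ∀ ω η, 0 ≤ χ ω η := fun ω η => (hχs0 η).trans (hχs ω η)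
  have hδ1 : δ ≤ 1 := by
    rw [hδ, ← hsum]
    exact Finset.sum_le_sum fun η _ => by nlinarith [hp η, hχs η η, hχ1 η η]
  have hq : ∀ ω, 0 ≤ p ω * ∑ η, p η * χ ω η := fun ω =>
    mul_nonneg (hp ω) (Finset.sum_nonneg fun η _ => mul_nonneg (hp η) (hχ0 ω η))
  refine nonneg_of_contraction I D T
    (fun F G : Ω → ℝ => (∑ ω, p ω * (∑ η, p η * χ ω η) * (F ω * G ω)) * (∑ ω, p ω * (∑ η, p η * χ ω η)) -
        (∑ ω, p ω * (∑ η, p η * χ ω η) * F ω) * (∑ ω, p ω * (∑ η, p η * χ ω η) * G ω))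
    (1 - δ) ((∑ ω, p ω * ∑ η, p η * χ ω η) * (∑ ω, p ω * ∑ η, p η * χ ω η))
    (sub_nonneg.2 hδ1) (by linarith) hTI hTD ?_ ?_ ?_ ?_ F G hF hG
  · intro F G hF hG
    exact twoCopyForm_step p hp χ hχ hχ0 F G (T F) (T G) (hT F) (hT G) (hPAI F G hF hG)
  · intro F G hF hG
    exact twoCopyForm_step p hp χ hχ hχ0 F G (T F) (T G) (hT F) (hT G) (hPAD F G hF hG)
  · intro F a L _ hF
    exact averaging_contraction p hp hsum χ hχ1 χs hχs0 hχs δ hδ hδpos F (T F) (hT F) a L hF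
  · intro F G a L c K hL _ hF hG
    exact twoCopyForm_abs_le (fun ω => p ω * ∑ η, p η * χ ω η) hq F G a L c K hL hF hG

/-- **Cross-copy ≤ same-copy (generic "hard-core Harris").**  Under the hypotheses of `twoCopyForm_nonneg` and with `I`
closed under subtracting `D`, for `a, b ∈ I`:  `∑_ω p ω a ω m_b ω ≤ ∑_ω q ω a ω b ω` — pairing `a` in one copy with `b`
in a compatible INDEPENDENT copy gives at most pairing them in the same copy.  Proof: `B(a, b − T b) ≥ 0` and
`∑ q (b − T b) = 0`. [folklore] -/
theorem twoCopy_cross_le (p : Ω → ℝ) (hp : ∀ ω, 0 ≤ p ω) (hsum : ∑ ω, p ω = 1) (χ : Ω → Ω → ℝ)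
    (hχ : ∀ ω η, χ ω η = χ η ω) (hχ1 : ∀ ω η, χ ω η ≤ 1) (χs : Ω → ℝ) (hχs0 : ∀ η, 0 ≤ χs η)
    (hχs : ∀ ω η, χs η ≤ χ ω η) (δ : ℝ) (hδ : δ = ∑ η, p η * χs η) (hδpos : 0 < δ)
    (I D : (Ω → ℝ) → Prop) (T : (Ω → ℝ) → (Ω → ℝ))
    (hT : ∀ (X : Ω → ℝ) ω, T X ω * (∑ η, p η * χ ω η) = ∑ η, p η * (X η * χ ω η))
    (hTI : ∀ F, I F → D (T F)) (hTD : ∀ F, D F → I (T F))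
    (hPAI : ∀ F G, I F → I G → ∀ ω, (∑ η, p η * (F η * χ ω η)) * (∑ η, p η * (G η * χ ω η)) ≤
      (∑ η, p η * (F η * G η * χ ω η)) * (∑ η, p η * χ ω η))
    (hPAD : ∀ F G, D F → D G → ∀ ω, (∑ η, p η * (F η * χ ω η)) * (∑ η, p η * (G η * χ ω η)) ≤
      (∑ η, p η * (F η * G η * χ ω η)) * (∑ η, p η * χ ω η))
    (hIsub : ∀ F G, I F → D G → I (fun ω => F ω - G ω))
    (a b : Ω → ℝ) (ha : I a) (hb : I b) :
    ∑ ω, p ω * (a ω * ∑ η, p η * (b η * χ ω η)) ≤ ∑ ω, p ω * (∑ η, p η * χ ω η) * (a ω * b ω) := by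
  have hχ0 : ∀ ω η, 0 ≤ χ ω η := fun ω η => (hχs0 η).trans (hχs ω η)
  have hc : I (fun ω => b ω - T b ω) := hIsub b (T b) hb (hTI b hb)
  have h0 := twoCopyForm_nonneg p hp hsum χ hχ hχ1 χs hχs0 hχs δ hδ hδpos I D T hT hTI hTD hPAI hPAD
    a (fun ω => b ω - T b ω) ha hc
  -- `∑ q (b - T b) = 0`
  have hmean : ∑ ω, p ω * (∑ η, p η * χ ω η) * (fun ω => b ω - T b ω) ω = 0 := by
    have h := averaging_mean p χ hχ b (T b) (hT b)
    simp only [mul_sub, Finset.sum_sub_distrib, h, sub_self]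
  rw [hmean, mul_zero, sub_zero] at h0
  -- `∑ q > 0`
  have hδr : ∀ ω, δ ≤ ∑ η, p η * χ ω η := fun ω => by
    rw [hδ]; exact Finset.sum_le_sum fun η _ => mul_le_mul_of_nonneg_left (hχs ω η) (hp η)
  have hQ : 0 < ∑ ω, p ω * ∑ η, p η * χ ω η := by
    have h1 : δ ≤ ∑ ω, p ω * ∑ η, p η * χ ω η := by
      calc δ = ∑ ω, p ω * δ := by rw [← Finset.sum_mul, hsum, one_mul]
        _ ≤ ∑ ω, p ω * ∑ η, p η * χ ω η := Finset.sum_le_sum fun ω _ => mul_le_mul_of_nonneg_left (hδr ω) (hp ω)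
    exact hδpos.trans_le h1
  have h1 : 0 ≤ ∑ ω, p ω * (∑ η, p η * χ ω η) * (a ω * (fun ω => b ω - T b ω) ω) :=
    nonneg_of_mul_nonneg_left h0 hQ
  -- unfold `a (b - T b)` and use `T b · r = m_b`
  have h2 : ∑ ω, p ω * (∑ η, p η * χ ω η) * (a ω * (fun ω => b ω - T b ω) ω) =
      ∑ ω, p ω * (∑ η, p η * χ ω η) * (a ω * b ω) - ∑ ω, p ω * (a ω * ∑ η, p η * (b η * χ ω η)) := by
    rw [← Finset.sum_sub_distrib]
    exact Finset.sum_congr rfl fun ω _ => by simp only [← hT b ω]; ring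
  rw [h2] at h1
  linarith

end Consts.TwoCopy

end Summit.CriticalPhenomena.PercolationContinuityZ3.Theorems
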